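import Literature.Geometry.Kaehler.ComplexTorusLefschetzDualPontryagin
import Literature.Geometry.Kaehler.ComplexTorusBeauvilleFourierAnyBasis
import HarnessLib

/-!
# `Λ = -ε · (c_L ⋆ ·)` for every polarised complex torus, on any lattice basis
# (Künnemann 1993 / Polishchuk 2007 §1; Kleiman's `B(X)` for abelian varieties at torus level)

[cite: Polishchuk2007FourierStable, §1 (p. 3, after [K] = Künnemann 1993)]
[cite: Voisin2002, §6.2.1 Lemma 6.19]
[cite: Lange2023AbelianVarietiesComplex, §6.3.2 Thm. 6.3.6 p. 316; §2.5.3 p. 133]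

Row A4-55 (`ComplexTorusLefschetzDualPontryagin`, prover p08) proves, for a polarisation `η = E` of type
`(d₁, …, d_g)` on the complex torus `X = E/Φ(ℤ^ι)` PRESENTED BY A SYMPLECTIC LATTICE BASIS
(`IsSymplecticEnum Φ e₀ η d`, Lange's standing convention of §2.5.3 "Fix a symplectic basis of
`Λ = H₁(X, ℤ)` for `L`"), that Voisin's dual Lefschetz operator `Λ_η` of row A4-54 is the Pontryagin product
with Lange's class `c_L = c₁(L)^{∧(g-1)}/(d (g-1)!)`:
`Λ_η x = -ε · (c_L ⋆ x)` for every `x ∈ H^{m+2}(X, ℚ)`, `ε = sign(E₂) sign(e)` the orientation character of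
the lattice frames of `⋆` (`IsSymplecticEnum.coe_lefschetzDual_eq_neg_sign_smul_pontryaginForms_curveClass`)
— Polishchuk's "`f(x) = (d^{g-1}/((g-1)! χ(d))) ∗ x`" (after Künnemann) read on cohomology. The printed
statement carries no choice of basis: `Λ_η` (`lefschetzDual η m`) and `c_L` are defined by `η` alone, and
the Pontryagin product `⋆ = μ_*(pr₁^* · ∪ pr₂^* ·)` is intrinsic.

THIS FILE REMOVES THE CHOICE: the identity holds for EVERY period isomorphism `Φ : ℝ^ι ≃ E`, every Riemann
form `η` of type `d` on its lattice (`IsRiemannForm Φ η`, `IsPolarizationType Φ η d`) and all lattice frames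
`E₂`, `e` (`IsPolarizationType.coe_lefschetzDual_eq_neg_sign_smul_pontryaginForms_curveClass`, and the
like-oriented / `ℚ`-linear-map forms). Proof by re-basing transport
(`ComplexTorusBeauvilleFourierAnyBasis`): `rebase Φ b` is a symplectic presentation of the same torus
(`isSymplecticEnum_rebase`), A4-55 applies to it, `Λ_η` and `c_L` are literally unchanged, and the
Pontryagin product of `H•(X, ℚ)` is lattice-basis-free up to the orientation character of its frames
(`coe_pontryaginForms_rebase`, through the basis-free Fourier transform `fourierForm_rebase` and
Prop. 6.2.18 (a)); the two characters multiply to `ε`.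

Consequence recorded: Kleiman's standard conjecture `B(X)` of Lefschetz type at torus level — `Λ` on
`H•(X, ℚ)` is `-ε` times the Pontryagin product with the rational divisor power `c_L`, an algebraic
correspondence — now for EVERY polarised complex torus (every abelian variety), not only for symplectically
presented ones (`IsPolarizationType.ratLefschetzDual_eq_neg_sign_smul_pontryaginForms_curveClass`).

Carrier: Layer-A2 lattice/period-matrix model `ComplexTorus`; theorems only; NO definition, NO named fact.
-/

noncomputable section

set_option maxSynthPendingDepth 3

open Module Complex Function Finset
open Literature.LinearAlgebra.Alternating

namespace Literature.Geometry.Kaehler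

namespace ComplexTorus

universe uE

section Main

variable {ι : Type*} [Fintype ι] [LinearOrder ι] {E : Type uE} [NormedAddCommGroup E] [NormedSpace ℂ E]
  [FiniteDimensional ℂ E] (Φ : (ι → ℝ) ≃L[ℝ] E) {n : ℕ} {η : E [⋀^Fin 2]→L[ℝ] ℝ} {d : Fin (n + 1) → ℕ}

omit [LinearOrder ι] [FiniteDimensional ℂ E] in
/-- Degree bookkeeping: the frames of `c_L ⋆ ·` force `2g = 2n + 2 = m + 2 + k`.
[cite: Lange2023AbelianVarietiesComplex, §1.1.3] -/
private theorem card_bookkeeping {k m : ℕ} (E₂ : Fin ((2 * n + (m + 2)) + (2 + k)) ≃ ι ⊕ ι)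
    (e : Fin (m + (2 + k)) ≃ ι) : 2 * n + 2 = m + (2 + k) := by
  have h1 := Fintype.card_congr e
  have h2 := Fintype.card_congr E₂
  simp only [Fintype.card_fin, Fintype.card_sum] at h1 h2
  omega

omit [Fintype ι] [LinearOrder ι] [FiniteDimensional ℂ E] in
/-- `(ε'ε') · (ε'ε) = ε` for orientation characters `ε' = ±1`. [folklore] -/
private theorem sign_bookkeeping {a b c : ℤ} (ha : a * a = 1) (hb : b * b = 1) :
    ((a * b : ℤ) : ℂ) * (((a * b) * c : ℤ) : ℂ) = (c : ℂ) := by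
  rw [← Int.cast_mul, ← mul_assoc, mul_mul_mul_comm, ha, hb, one_mul, one_mul]

/-- **`Λ_η = -ε · (c_L ⋆ ·)` for EVERY polarised complex torus and EVERY lattice basis.** Let `η = E` be a
Riemann form of type `(d₁, …, d_g)` on the lattice of `X = E/Φ(ℤ^ι)` (`g = n + 1`, `d = d₁⋯d_g = h⁰(L)`,
`c₁(L) = -[E]`, `c_L = c₁(L)^{∧(g-1)}/(d (g-1)!) ∈ H^{2g-2}(X, ℚ)`), `Λ_η` Voisin's dual Lefschetz operator
(row A4-54) and `⋆` the cohomological Pontryagin product on lattice frames `E₂` (of `Λ ⊕ Λ`) and `e` (of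
`Λ`). Then for every `x ∈ H^{m+2}(X, ℚ)`: **`Λ_η x = -ε · (c_L ⋆ x)`**, `ε = sign(E₂) sign(e)`. The
symplectic-basis case is row A4-55; the general case is transported from the symplectic re-presentation
`rebase Φ b` (`Λ_η`, `c_L` unchanged; `⋆` changes by the product of the orientation characters,
`coe_pontryaginForms_rebase`). [cite: Polishchuk2007FourierStable, §1 (p. 3, after Künnemann 1993)]
[cite: Voisin2002, §6.2.1 Lemma 6.19] [cite: Lange2023AbelianVarietiesComplex, §6.3.2 p. 316] -/
theorem IsPolarizationType.coe_lefschetzDual_eq_neg_sign_smul_pontryaginForms_curveClass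
    (hd : IsPolarizationType Φ η d) (hη : IsRiemannForm Φ η) {k m : ℕ}
    (E₂ : Fin ((2 * n + (m + 2)) + (2 + k)) ≃ ι ⊕ ι) (e : Fin (m + (2 + k)) ≃ ι) (x : rationalForms Φ (m + 2)) :
    lefschetzDual η m x =
      -(((orientationSign (prodPeriod Φ Φ) E₂ * orientationSign Φ e : ℤ) : ℂ) •
        (pontryaginForms Φ E₂ e rfl rfl (hη.isNSForm.curveClass Φ (∏ i, d i) n) x : E [⋀^Fin m]→L[ℝ] ℂ)) := by
  have HN : 2 * n + 2 = m + (2 + k) := card_bookkeeping E₂ e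
  obtain ⟨hdvd, b, huu, hvv, huv⟩ := hd
  have hs : IsSymplecticEnum (rebase Φ b) (Equiv.refl _) η d := isSymplecticEnum_rebase Φ b hdvd huu hvv huv
  have hη' : IsRiemannForm (rebase Φ b) η := (isRiemannForm_rebase_iff Φ b).2 hη
  obtain ⟨σ⟩ : Nonempty (ι ≃ (Fin (n + 1) ⊕ Fin (n + 1))) := ⟨(b.indexEquiv (Pi.basisFun ℤ ι)).symm⟩
  -- the class `x` and `c_L` on the (equal) rational carriers of the re-presented torus
  have hx2 : (x : E [⋀^Fin (m + 2)]→L[ℝ] ℂ) ∈ rationalForms (rebase Φ b) (m + 2) := by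
    rw [rationalForms_rebase]; exact x.2
  have hc : ((hη'.isNSForm.curveClass (rebase Φ b) (∏ i, d i) n : rationalForms (rebase Φ b) (2 * n)) :
      E [⋀^Fin (2 * n)]→L[ℝ] ℂ) = (hη.isNSForm.curveClass Φ (∏ i, d i) n : E [⋀^Fin (2 * n)]→L[ℝ] ℂ) := by
    rw [IsNSForm.coe_curveClass, IsNSForm.coe_curveClass]
  -- an auxiliary linear order on the symplectic index type, keeping its decidable equality
  letI : LinearOrder (Fin (n + 1) ⊕ Fin (n + 1)) :=
    linearOrderOfOrientation (finSumFinEquiv.symm : Fin ((n + 1) + (n + 1)) ≃ Fin (n + 1) ⊕ Fin (n + 1))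
  -- `⋆` of the re-presented torus vs `⋆` of `Φ`
  have hP := coe_pontryaginForms_rebase Φ b (((finCongr HN).trans e).trans σ)
    (((finCongr (by omega : (m + 2) + k = m + (2 + k))).trans e).trans σ) (E₂.trans (σ.sumCongr σ)) (e.trans σ)
    ((finCongr HN).trans e) ((finCongr (by omega : (m + 2) + k = m + (2 + k))).trans e) E₂ e
    (hη'.isNSForm.curveClass (rebase Φ b) (∏ i, d i) n) ⟨x, hx2⟩ (hη.isNSForm.curveClass Φ (∏ i, d i) n) x hc rfl
  have hε := sign_bookkeeping (c := orientationSign (prodPeriod Φ Φ) E₂ * orientationSign Φ e)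
    (orientationSign_mul_self (prodPeriod (rebase Φ b) (rebase Φ b)) (E₂.trans (σ.sumCongr σ)))
    (orientationSign_mul_self (rebase Φ b) (e.trans σ))
  have key := hs.coe_lefschetzDual_eq_neg_sign_smul_pontryaginForms_curveClass _ hη' (E₂.trans (σ.sumCongr σ))
    (e.trans σ) ⟨x, hx2⟩
  rw [hP, smul_smul, hε] at key
  exact key

/-- **`Λ_η = -(c_L ⋆ ·)` on like-oriented frames, for every polarised complex torus** (`sign(E₂) = sign(e)`:
the complex orientations of `X × X` and `X`, the canonical `μ_*`).
[cite: Polishchuk2007FourierStable, §1 (p. 3)] [cite: Voisin2002, §6.2.1 Lemma 6.19] -/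
theorem IsPolarizationType.coe_lefschetzDual_eq_neg_pontryaginForms_curveClass_of_orientationSign_eq
    (hd : IsPolarizationType Φ η d) (hη : IsRiemannForm Φ η) {k m : ℕ}
    (E₂ : Fin ((2 * n + (m + 2)) + (2 + k)) ≃ ι ⊕ ι) (e : Fin (m + (2 + k)) ≃ ι)
    (hE : orientationSign (prodPeriod Φ Φ) E₂ = orientationSign Φ e) (x : rationalForms Φ (m + 2)) :
    lefschetzDual η m x =
      -(pontryaginForms Φ E₂ e rfl rfl (hη.isNSForm.curveClass Φ (∏ i, d i) n) x : E [⋀^Fin m]→L[ℝ] ℂ) := by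
  rw [hd.coe_lefschetzDual_eq_neg_sign_smul_pontryaginForms_curveClass Φ hη E₂ e x, hE, orientationSign_mul_self,
    Int.cast_one, one_smul]

/-- **`Λ = -ε · (c_L ⋆ ·)` as `ℚ`-linear maps `H^{m+2}(X, ℚ) → Hᵐ(X, ℚ)`, for EVERY polarised complex torus**
(skel-4's `IsNSForm.ratLefschetzDual` of row A4-54″): `Λ` is induced by the correspondence
`x ↦ μ_*(pr₁^*(-ε c_L) ∪ pr₂^* x)` built from a rational divisor power — the algebraicity of `Λ`, Kleiman's
conjecture `B(X)` of Lefschetz type, for every abelian variety at torus level (no symplectic presentation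
assumed). [cite: Polishchuk2007FourierStable, §1 (p. 3)] [cite: Voisin2002, §7.1.2] -/
theorem IsPolarizationType.ratLefschetzDual_eq_neg_sign_smul_pontryaginForms_curveClass
    (hd : IsPolarizationType Φ η d) (hη : IsRiemannForm Φ η) {k m : ℕ}
    (E₂ : Fin ((2 * n + (m + 2)) + (2 + k)) ≃ ι ⊕ ι) (e : Fin (m + (2 + k)) ≃ ι) :
    hη.isNSForm.ratLefschetzDual Φ (fun v hv ↦ hη.exists_apply_ne_zero Φ v hv) m =
      -(((orientationSign (prodPeriod Φ Φ) E₂ * orientationSign Φ e : ℤ) : ℚ) •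
        pontryaginForms Φ E₂ e rfl rfl (hη.isNSForm.curveClass Φ (∏ i, d i) n)) := by
  refine LinearMap.ext fun x ↦ Subtype.ext ?_
  rw [IsNSForm.coe_ratLefschetzDual, hd.coe_lefschetzDual_eq_neg_sign_smul_pontryaginForms_curveClass Φ hη E₂ e x,
    LinearMap.neg_apply, LinearMap.smul_apply, Submodule.coe_neg, Submodule.coe_smul, ← Rat.cast_smul_eq_qsmul ℂ,
    Rat.cast_intCast]

end Main

end ComplexTorus

end Literature.Geometry.Kaehler

end
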